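import Summits.AnomalousDissipation.AnomalousDissipation.Theorems.SolenoidalFractalHomogenisationRealisedQuasiStaticCellLawSlavedSectorSlot
import Summits.AnomalousDissipation.AnomalousDissipation.Theorems.SolenoidalFractalHomogenisationRealisedQuasiStaticCellLawLinkBound
import Summits.AnomalousDissipation.AnomalousDissipation.Theorems.SolenoidalFractalHomogenisationRealisedQuasiStaticCellLawSectorExpDecay
import HarnessLib

/-!
# K2R `RealisedQuasiStaticCellLaw`, line `floquet-bloch`, stub `stub_upperSome`: bookkeeping of the sector truncation in
# slot form (total energy non-increasing, frame components, principal/rest split of the fast energy, rest-block decay)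

Summits-side helper file (everything proved; no definitions, no named facts; `--supports stmt-AnomalousDissipation-20446`).
The bookkeeping of `slavedSector_slot_contraction` (`…SlavedSectorSlot`, S1D), exported as lemmas for the `stub_upperSome` lane:
(the truncation energy `E(t) = Σ_{k∈freqBall N}‖α_N(t)(k)‖²` is non-increasing: `totalEnergy_antitone` of `…SectorExpDecay`),
`norm_inner_toLp_ofReal_le` (components along cast real vectors of length `≤ 1`), `sector_fast_split` (inside slot `j`,
`E − 2‖α_N(ℓ)‖²` = twice the fast energy of the principal coset in the frame `(ζ_j, p_J)` + the energy of the rest block `F`),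
`sector_rest_decay` (`F` decays by `exp(−8π²κ(n/2)²τ_j)` over the full slot). No new mathematics; not anomalous dissipation.
-/

set_option linter.dupNamespace false -- layout D-0017: `AnomalousDissipation.AnomalousDissipation` repeats by design

noncomputable section

namespace Summit.AnomalousDissipation.AnomalousDissipation.Theorems.SolenoidalFractalHomogenisation.RealisedQuasiStaticCellLaw

open Set MeasureTheory Filter Topology Function Complex Matrix
open scoped InnerProductSpace ComplexConjugate Matrix BigOperators
open Literature.Analysis Literature.Analysis.FunctionSpaces Literature.Analysis.FunctionSpaces.Torus
open Literature.Analysis.FluidPDE Literature.Analysis.FluidPDE.LatticeShear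
open Summit.AnomalousDissipation.AnomalousDissipation.Theorems.SolenoidalFractalHomogenisation.PermissibleCarrier

variable {k₀ : ℕ}

/-! ## §1 Components along unit real vectors -/

/-- The component of a vector of `ℂ³` along a cast real vector of length `≤ 1` is at most its norm. -/
theorem norm_inner_toLp_ofReal_le {u : Fin 3 → ℝ} (hu : u ⬝ᵥ u ≤ 1) (y : EuclideanSpace ℂ (Fin 3)) :
    ‖inner ℂ (WithLp.toLp 2 (Complex.ofReal ∘ u) : EuclideanSpace ℂ (Fin 3)) y‖ ≤ ‖y‖ := by
  refine (norm_inner_le_norm _ _).trans ?_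
  have h1 : ‖(WithLp.toLp 2 (Complex.ofReal ∘ u) : EuclideanSpace ℂ (Fin 3))‖ ^ 2 = u ⬝ᵥ u := by
    rw [EuclideanSpace.norm_sq_eq, dotProduct]
    refine Finset.sum_congr rfl fun i _ => ?_
    simp [sq]
  have h2 : ‖(WithLp.toLp 2 (Complex.ofReal ∘ u) : EuclideanSpace ℂ (Fin 3))‖ ≤ 1 := by
    have h0 := norm_nonneg (WithLp.toLp 2 (Complex.ofReal ∘ u) : EuclideanSpace ℂ (Fin 3))
    nlinarith [h1, hu]
  exact (mul_le_of_le_one_left (norm_nonneg _) h2)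

/-! ## §2 The slot-wise split of the truncation energy and the decay of the rest block -/

/-- **Split of the fast energy of the sector truncation in slot form.** For the principal coset `ℓ + ℤK_j` (no zero
frequency on its resolved segment `Wset ∋ 0`, the two cosets `±(ℓ + ℤK_j)` disjoint) and the frame `(ζ, p_J)`:
`E(τ) − 2‖α_N(τ)(ℓ)‖² = 2Σ_{J∈Wset∖0}(‖⟪ζ,α_N(τ)(k_J)⟫‖² + ‖⟪p_J,α_N(τ)(k_J)⟫‖²) + Σ_{k∈F}‖α_N(τ)(k)‖²`, `F` the rest block
(the ball minus the two principal cosets), and `‖α_N(τ)(ℓ)‖² = ‖⟪ζ,α_N(τ)(ℓ)⟫‖² + ‖⟪p₀,α_N(τ)(ℓ)⟫‖²`, at every time `τ`. -/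
theorem sector_fast_split (W : LatticeWord k₀) {n : ℕ} (hn : 0 < n) {κ : ℝ} (hκ : 0 ≤ κ)
    (ℓ : Fin 3 → ℤ) {w₀ : UnitAddTorus (Fin 3) → EuclideanSpace ℝ (Fin 3)}
    (hw₀ : FunctionSpaces.Torus.MemSobolev 1 (FunctionSpaces.EuclideanSpace.complexify ∘ w₀))
    (hdiv : FunctionSpaces.Torus.IsWeaklyDivFree w₀) (hmean : FunctionSpaces.Torus.HasZeroMean w₀)
    (hsupp : ∀ k : Fin 3 → ℤ, ¬ ((∃ z : Fin 3 → ℤ, k = ℓ + (n:ℤ) • z) ∨ (∃ z : Fin 3 → ℤ, k = -ℓ + (n:ℤ) • z)) →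
      UnitAddTorus.mFourierCoeff (FunctionSpaces.EuclideanSpace.complexify ∘ w₀) k = 0)
    (N : ℕ) (j : Fin k₀)
    (hk : ∀ J : ℤ, ℓ + J • (fun i => (W.phase j).m i * (n : ℤ)) ∈ freqBall N → ℓ + J • (fun i => (W.phase j).m i * (n : ℤ)) ≠ 0)
    (hdisj : ∀ J J' : ℤ, ℓ + J • (fun i => (W.phase j).m i * (n : ℤ)) ≠ -(ℓ + J' • (fun i => (W.phase j).m i * (n : ℤ))))
    {ζr : Fin 3 → ℝ} (hζ1 : ζr ⬝ᵥ ζr = 1) (hζ0 : ζr ⬝ᵥ (fun i => ((ℓ i : ℤ) : ℝ)) = 0)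
    (hζK : ζr ⬝ᵥ (fun i => (((fun i => (W.phase j).m i * (n : ℤ)) i : ℤ) : ℝ)) = 0)
    {pf : ℤ → Fin 3 → ℝ}
    (hp : ∀ J : ℤ, pf J = (Real.sqrt ((fun i => (((ℓ + J • (fun i => (W.phase j).m i * (n : ℤ))) i : ℤ) : ℝ)) ⬝ᵥ
        (fun i => (((ℓ + J • (fun i => (W.phase j).m i * (n : ℤ))) i : ℤ) : ℝ))))⁻¹ • (fun i => (((ℓ + J • (fun i => (W.phase j).m i * (n : ℤ))) i : ℤ) : ℝ)) ⨯₃ ζr)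
    {Wset : Finset ℤ} (hW : ∀ J : ℤ, J ∈ Wset ↔ ℓ + J • (fun i => (W.phase j).m i * (n : ℤ)) ∈ freqBall N) (h0 : (0 : ℤ) ∈ Wset) (τ : ℝ) :
    (∑ k ∈ freqBall N, ‖(pvSetup_cell W hn hκ ℓ hw₀ hdiv hmean hsupp).galerkinCoeffAt N τ k‖ ^ 2 - 2 * ‖(pvSetup_cell W hn hκ ℓ hw₀ hdiv hmean hsupp).galerkinCoeffAt N τ ℓ‖ ^ 2 =
      2 * ∑ J ∈ Wset.erase 0, (‖inner ℂ (WithLp.toLp 2 (Complex.ofReal ∘ ζr) : EuclideanSpace ℂ (Fin 3)) ((pvSetup_cell W hn hκ ℓ hw₀ hdiv hmean hsupp).galerkinCoeffAt N τ (ℓ + J • (fun i => (W.phase j).m i * (n : ℤ))))‖ ^ 2 +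
          ‖inner ℂ (WithLp.toLp 2 (Complex.ofReal ∘ pf J) : EuclideanSpace ℂ (Fin 3)) ((pvSetup_cell W hn hκ ℓ hw₀ hdiv hmean hsupp).galerkinCoeffAt N τ (ℓ + J • (fun i => (W.phase j).m i * (n : ℤ))))‖ ^ 2) +
        ∑ k ∈ (freqBall N \ (Wset.image (fun J : ℤ => ℓ + J • (fun i => (W.phase j).m i * (n : ℤ))) ∪ (Wset.image (fun J : ℤ => ℓ + J • (fun i => (W.phase j).m i * (n : ℤ)))).image (fun k => -k))), ‖(pvSetup_cell W hn hκ ℓ hw₀ hdiv hmean hsupp).galerkinCoeffAt N τ k‖ ^ 2) ∧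
    ‖(pvSetup_cell W hn hκ ℓ hw₀ hdiv hmean hsupp).galerkinCoeffAt N τ ℓ‖ ^ 2 = ‖inner ℂ (WithLp.toLp 2 (Complex.ofReal ∘ ζr) : EuclideanSpace ℂ (Fin 3)) ((pvSetup_cell W hn hκ ℓ hw₀ hdiv hmean hsupp).galerkinCoeffAt N τ ℓ)‖ ^ 2 +
      ‖inner ℂ (WithLp.toLp 2 (Complex.ofReal ∘ pf 0) : EuclideanSpace ℂ (Fin 3)) ((pvSetup_cell W hn hκ ℓ hw₀ hdiv hmean hsupp).galerkinCoeffAt N τ ℓ)‖ ^ 2 := by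
  classical
  set hPV := pvSetup_cell W hn hκ ℓ hw₀ hdiv hmean hsupp with hPVdef
  set K : Fin 3 → ℤ := (fun i => (W.phase j).m i * (n : ℤ)) with hK
  set ζc : EuclideanSpace ℂ (Fin 3) := WithLp.toLp 2 (Complex.ofReal ∘ ζr) with hζc
  set pc : ℤ → EuclideanSpace ℂ (Fin 3) := fun J => WithLp.toLp 2 (Complex.ofReal ∘ pf J) with hpc
  set E : (Fin 3 → ℤ) → ℝ := fun k => ‖hPV.galerkinCoeffAt N τ k‖ ^ 2 with hE
  set Eo : ℤ → ℝ := fun J => ‖inner ℂ ζc (hPV.galerkinCoeffAt N τ (ℓ + J • K))‖ ^ 2 with hEo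
  set Ei : ℤ → ℝ := fun J => ‖inner ℂ (pc J) (hPV.galerkinCoeffAt N τ (ℓ + J • K))‖ ^ 2 with hEi
  have hblocks : ∀ J ∈ Wset, E (ℓ + J • K) = Eo J + Ei J := by
    intro J hJ
    simp only [hE, hEo, hEi, hpc]
    rw [hp J]
    exact norm_sq_galerkinCoeffAt_eq_blocks W hn hκ ℓ hw₀ hdiv hmean hsupp N τ j ℓ J (hk J ((hW J).1 hJ)) hζ1 hζ0 hζK
  have hsplit0 : E ℓ = Eo 0 + Ei 0 := by have := hblocks 0 h0; simpa using this
  set Pp : Finset (Fin 3 → ℤ) := Wset.image (fun J : ℤ => ℓ + J • K) with hPp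
  set Pm : Finset (Fin 3 → ℤ) := Pp.image (fun k => -k) with hPm
  have hK0 : K ≠ 0 := cellFreq_ne_zero (W.phase j) hn
  have hPpS : Pp ⊆ freqBall N := by
    intro k hk'
    obtain ⟨J, hJ, rfl⟩ := Finset.mem_image.1 hk'
    exact (hW J).1 hJ
  have hPmS : Pm ⊆ freqBall N := by
    intro k hk'
    obtain ⟨k', hk'P, rfl⟩ := Finset.mem_image.1 hk'
    exact neg_mem_freqBall_of_mem _ (hPpS hk'P)
  have hUS : Pp ∪ Pm ⊆ freqBall N := Finset.union_subset hPpS hPmS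
  have hPdisj : Disjoint Pp Pm := by
    rw [Finset.disjoint_left]
    intro k hkP hkM
    obtain ⟨J, _, rfl⟩ := Finset.mem_image.1 hkP
    obtain ⟨k', hk'P, hk'eq⟩ := Finset.mem_image.1 hkM
    obtain ⟨J', _, rfl⟩ := Finset.mem_image.1 hk'P
    exact hdisj J J' hk'eq.symm
  have hsplit : ∑ k ∈ freqBall N, E k = 2 * ∑ J ∈ Wset, E (ℓ + J • K) + ∑ k ∈ freqBall N \ (Pp ∪ Pm), E k := by
    have hPp_sum : ∑ k ∈ Pp, E k = ∑ J ∈ Wset, E (ℓ + J • K) := by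
      rw [hPp, Finset.sum_image (fun J _ J' _ h => coset_injective hK0 ℓ h)]
    have hPm_sum : ∑ k ∈ Pm, E k = ∑ k ∈ Pp, E k := by
      rw [hPm, Finset.sum_image (fun k _ k' _ h => neg_injective h)]
      refine Finset.sum_congr rfl fun k _ => ?_
      simp only [hE]
      rw [norm_galerkinCoeffAt_neg W hn hκ ℓ hw₀ hdiv hmean hsupp]
    rw [← Finset.sum_sdiff hUS, Finset.sum_union hPdisj, hPm_sum, hPp_sum]
    ring
  have hsumW : ∑ J ∈ Wset, E (ℓ + J • K) = (Eo 0 + Ei 0) + ∑ J ∈ Wset.erase 0, (Eo J + Ei J) := by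
    rw [Finset.sum_congr rfl hblocks, ← Finset.add_sum_erase Wset _ h0]
  refine ⟨?_, by simpa only [hE, hEo, hEi, hpc, zero_smul, add_zero] using hsplit0⟩
  have key : ∑ k ∈ freqBall N, E k - 2 * E ℓ =
      2 * ∑ J ∈ Wset.erase 0, (Eo J + Ei J) + ∑ k ∈ freqBall N \ (Pp ∪ Pm), E k := by
    rw [hsplit, hsumW, hsplit0]; ring
  simpa only [hE, hEo, hEi, hpc, hPp, hPm] using key

/-- **Decay of the rest block over a full slot.** With `2|ℓ| ≤ n`, the rest block `F` (the ball minus the two principal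
cosets of slot `j`) is symmetric, invariant under `k ↦ k ± K_j` inside the ball and carries only frequencies `|k| ≥ n/2`
of the sector; hence over the full slot `[pP + start j, pP + start j + τ_j]` its energy decays by
`exp(−8π²κ(n/2)²τ_j)` (`restBlock_decay_fullSlot`; the closure bookkeeping of `slavedSector_slot_contraction`, exported). -/
theorem sector_rest_decay (W : LatticeWord k₀) {n : ℕ} (hn : 0 < n) {κ : ℝ} (hκ : 0 ≤ κ)
    (ℓ : Fin 3 → ℤ) {w₀ : UnitAddTorus (Fin 3) → EuclideanSpace ℝ (Fin 3)}
    (hw₀ : FunctionSpaces.Torus.MemSobolev 1 (FunctionSpaces.EuclideanSpace.complexify ∘ w₀))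
    (hdiv : FunctionSpaces.Torus.IsWeaklyDivFree w₀) (hmean : FunctionSpaces.Torus.HasZeroMean w₀)
    (hsupp : ∀ k : Fin 3 → ℤ, ¬ ((∃ z : Fin 3 → ℤ, k = ℓ + (n:ℤ) • z) ∨ (∃ z : Fin 3 → ℤ, k = -ℓ + (n:ℤ) • z)) →
      UnitAddTorus.mFourierCoeff (FunctionSpaces.EuclideanSpace.complexify ∘ w₀) k = 0)
    (hℓn : 2 * ‖latticeVec ℓ‖ ≤ n)
    {N : ℕ} (hBN : (Finset.univ.biUnion fun j : Fin k₀ =>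
        ({(fun i => (W.phase j).m i * n), -(fun i => (W.phase j).m i * n)} : Finset (Fin 3 → ℤ))) ⊆ freqBall N)
    {T : ℝ} (p : ℕ) (j : Fin k₀) (hT : (p : ℝ) * W.period + W.start j + (W.phase j).τ ≤ T)
    {Wset : Finset ℤ} (hW : ∀ J : ℤ, J ∈ Wset ↔ ℓ + J • (fun i => (W.phase j).m i * (n : ℤ)) ∈ freqBall N) :
    ∑ k ∈ (freqBall N \ (Wset.image (fun J : ℤ => ℓ + J • (fun i => (W.phase j).m i * (n : ℤ))) ∪ (Wset.image (fun J : ℤ => ℓ + J • (fun i => (W.phase j).m i * (n : ℤ)))).image (fun k => -k))), ‖(pvSetup_cell W hn hκ ℓ hw₀ hdiv hmean hsupp).galerkinCoeffAt N ((p : ℝ) * W.period + W.start j + (W.phase j).τ) k‖ ^ 2 ≤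
      Real.exp (-(8 * Real.pi ^ 2 * κ * ((n : ℝ) / 2) ^ 2) * (W.phase j).τ) *
        ∑ k ∈ (freqBall N \ (Wset.image (fun J : ℤ => ℓ + J • (fun i => (W.phase j).m i * (n : ℤ))) ∪ (Wset.image (fun J : ℤ => ℓ + J • (fun i => (W.phase j).m i * (n : ℤ)))).image (fun k => -k))), ‖(pvSetup_cell W hn hκ ℓ hw₀ hdiv hmean hsupp).galerkinCoeffAt N ((p : ℝ) * W.period + W.start j) k‖ ^ 2 := by
  classical
  set hPV := pvSetup_cell W hn hκ ℓ hw₀ hdiv hmean hsupp with hPVdef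
  set K : Fin 3 → ℤ := (fun i => (W.phase j).m i * (n : ℤ)) with hK
  set Pp : Finset (Fin 3 → ℤ) := Wset.image (fun J : ℤ => ℓ + J • K) with hPp
  set Pm : Finset (Fin 3 → ℤ) := Pp.image (fun k => -k) with hPm
  set U : Finset (Fin 3 → ℤ) := Pp ∪ Pm with hU
  set F : Finset (Fin 3 → ℤ) := freqBall N \ U with hF
  have hFS : F ⊆ freqBall N := Finset.sdiff_subset
  have hmemPp : ∀ J : ℤ, ℓ + J • K ∈ freqBall N → ℓ + J • K ∈ Pp := fun J hJ =>
    Finset.mem_image.2 ⟨J, (hW J).2 hJ, rfl⟩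
  have hmemPm : ∀ J : ℤ, ℓ + J • K ∈ freqBall N → -(ℓ + J • K) ∈ Pm := fun J hJ =>
    Finset.mem_image.2 ⟨ℓ + J • K, hmemPp J hJ, rfl⟩
  have hUsymm : ∀ k ∈ U, -k ∈ U := by
    intro k hk'
    rw [hU, Finset.mem_union] at hk' ⊢
    rcases hk' with h | h
    · exact Or.inr (Finset.mem_image.2 ⟨k, h, rfl⟩)
    · obtain ⟨k', hk'P, rfl⟩ := Finset.mem_image.1 h
      rw [neg_neg]; exact Or.inl hk'P
  have hFsymm : ∀ k ∈ F, -k ∈ F := by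
    intro k hk'
    rw [hF, Finset.mem_sdiff] at hk' ⊢
    refine ⟨neg_mem_freqBall_of_mem _ hk'.1, fun h => hk'.2 ?_⟩
    have := hUsymm _ h
    rwa [neg_neg] at this
  have hUadd : ∀ k, k + K ∈ U → k ∈ freqBall N → k ∈ U := by
    intro k hkU hkS
    rw [hU, Finset.mem_union] at hkU ⊢
    rcases hkU with h | h
    · obtain ⟨J, _, hJk⟩ := Finset.mem_image.1 h
      have hk' : k = ℓ + (J - 1) • K := by rw [sub_smul, one_smul, ← add_sub_assoc, hJk]; abel
      rw [hk'] at hkS ⊢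
      exact Or.inl (hmemPp _ hkS)
    · obtain ⟨k', hk'P, hk'eq⟩ := Finset.mem_image.1 h
      obtain ⟨J, _, hJk⟩ := Finset.mem_image.1 hk'P
      have hk' : k = -(ℓ + (J + 1) • K) := by
        rw [add_smul, one_smul, ← add_assoc, hJk, neg_add, hk'eq]; abel
      rw [hk'] at hkS ⊢
      have hkS' : ℓ + (J + 1) • K ∈ freqBall N := by
        have := neg_mem_freqBall_of_mem _ hkS
        rwa [neg_neg] at this
      exact Or.inr (hmemPm _ hkS')
  have hUsub : ∀ k, k - K ∈ U → k ∈ freqBall N → k ∈ U := by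
    intro k hkU hkS
    have h1' : -k + K ∈ U := by
      have := hUsymm _ hkU
      rwa [neg_sub, sub_eq_neg_add] at this
    have h2 := hUadd (-k) h1' (neg_mem_freqBall_of_mem _ hkS)
    have := hUsymm _ h2
    rwa [neg_neg] at this
  have hFadd : ∀ k ∈ F, k + K ∈ freqBall N → k + K ∈ F := by
    intro k hkF hkS
    rw [hF, Finset.mem_sdiff] at hkF ⊢
    exact ⟨hkS, fun h => hkF.2 (hUadd k h hkF.1)⟩
  have hFsub : ∀ k ∈ F, k - K ∈ freqBall N → k - K ∈ F := by
    intro k hkF hkS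
    rw [hF, Finset.mem_sdiff] at hkF ⊢
    exact ⟨hkS, fun h => hkF.2 (hUsub k h hkF.1)⟩
  have hRF : ∀ τ ∈ Icc ((p : ℝ) * W.period + W.start j) ((p : ℝ) * W.period + W.start j + (W.phase j).τ), ∀ k ∈ F,
      freqNormSq k < ((n : ℝ) / 2) ^ 2 → hPV.galerkinCoeffAt N τ k = 0 := by
    intro τ _ k hkF hlt
    by_cases hsec : k ∈ ({k | (∃ z : Fin 3 → ℤ, k = ℓ + (n:ℤ) • z) ∨ (∃ z : Fin 3 → ℤ, k = -ℓ + (n:ℤ) • z)} :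
        Set (Fin 3 → ℤ))
    · exfalso
      rw [hF, Finset.mem_sdiff] at hkF
      rcases hsec with ⟨z, hz⟩ | ⟨z, hz⟩
      · by_cases hz0 : z = 0
        · subst hz0
          have hkℓ : k = ℓ + (0 : ℤ) • K := by rw [hz]; simp
          exact hkF.2 (by rw [hU, Finset.mem_union]; exact Or.inl (hkℓ ▸ hmemPp 0 (hkℓ ▸ hkF.1)))
        · exact absurd hlt (not_lt.2 (half_le_norm_of_sector hz0 hℓn (Or.inl hz)))
      · by_cases hz0 : z = 0
        · subst hz0
          have hkℓ : k = -(ℓ + (0 : ℤ) • K) := by rw [hz]; simp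
          have hℓS : ℓ + (0 : ℤ) • K ∈ freqBall N := by
            have := neg_mem_freqBall_of_mem _ hkF.1
            rwa [hkℓ, neg_neg] at this
          exact hkF.2 (by rw [hU, Finset.mem_union]; exact Or.inr (hkℓ ▸ hmemPm 0 hℓS))
        · exact absurd hlt (not_lt.2 (half_le_norm_of_sector hz0 hℓn (Or.inr hz)))
    · exact hPV.galerkinCoeffAt_eq_zero N τ (Or.inl hsec)
  have h := restBlock_decay_fullSlot W hn hκ ℓ hw₀ hdiv hmean hsupp hBN p j hT hFS hFsymm hFadd hFsub
    (R := (n : ℝ) / 2) hRF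
  simpa only [hF, hU, hPp, hPm] using h

end Summit.AnomalousDissipation.AnomalousDissipation.Theorems.SolenoidalFractalHomogenisation.RealisedQuasiStaticCellLaw

end
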